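import Mathlib
import Literature.Computability.AlgebraicComplexity.DeterminantIrreducible

/-!
# The generic determinant is prime over any integral domain (crux `BeyondHessianNs`)

Helper file for crux item stmt-ValiantsHypothesis-5641 (`RefutationDegree.BeyondHessianNs`),
stub `stub_detPrimeOverDomain` of the line `Sketch` (inductive step of the multi-point jet
calibration: primality of the generic determinant in independent matrix variables over a
coefficient DOMAIN, not only over a field).

The tree file `Literature/Computability/AlgebraicComplexity/DeterminantIrreducible.lean` proves that
the generic determinant `detPoly n D = det (X_{ij})` is irreducible over every integral domain `D`
(`detPoly_irreducible`) and prime over a field (`detPoly_prime`, via unique factorisation). Over a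
general domain `D[X_{ij}]` need not be factorial, so we descend primality from the fraction field
`F = Frac D` by a division argument:

* `dvd_of_map_dvd_map` (contraction): for a monomial order `m` and `f ∈ D[X]` whose `m`-leading
  coefficient is a unit, `(f) F[X] ∩ D[X] = (f) D[X]`. Indeed, divide `a = g f + r` in `D[X]`
  with `r` reduced (`MonomialOrder.div_single`: no monomial of `r` is `≥ LM(f)`); if `f ∣ a` in
  `F[X]` then `f ∣ r` in `F[X]`, `r = f q`, and `q ≠ 0` would put the monomial
  `LM(f) + LM(q) ≥ LM(f)` in the support of `r` (`MonomialOrder.degree_mul` over the domain `F`,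
  supports are unchanged by the injective coefficient extension); so `r = 0`.
* `prime_of_prime_map` (descent): hence `f` prime in `F[X]` implies `f` prime in `D[X]`.
* every coefficient of `detPoly` is a sign `±1` (`coeff_detPoly`), so its leading coefficient for
  ANY monomial order is a unit (`isUnit_leadingCoeff_detPoly`), and `detPoly n D ↦ detPoly n F`
  under the coefficient extension (`map_detPoly`); `detPoly n F` is prime (`detPoly_prime`).

A monomial order on `n × n` is obtained as `MonomialOrder.lex` for a linear order lifted from
`Fintype.equivFin`. The stub `stub_detPrimeOverDomain` is the case `n = Fin k`, `0 < k`, stated for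
Mathlib's matrix of variables `Matrix.of fun i j => X (i, j) = Matrix.mvPolynomialX` (definitionally
`detPoly`). No new definitions.
-/

noncomputable section

-- single-conjunct layout: Sub = Summit, duplicated namespace component intended
set_option linter.dupNamespace false

namespace Summit.ValiantsHypothesis.ValiantsHypothesis.Theorems.RefutationDegreeBeyondHessianNs

open MvPolynomial

section Descent

variable {σ : Type*} {R S : Type*} [CommRing R] [CommRing S]

/-- The degree of a multivariate polynomial for a monomial order is unchanged under an injective
extension of coefficients (the support is unchanged). [folklore] -/
theorem monomialOrder_degree_map_of_injective (m : MonomialOrder σ) {ι : R →+* S}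
    (hι : Function.Injective ι) (f : MvPolynomial σ R) :
    m.degree (map ι f) = m.degree f := by
  unfold MonomialOrder.degree
  rw [support_map_of_injective f hι]

/-- **Contraction lemma.** Let `ι : R → S` be an injective ring map into a domain, `m` a monomial
order and `f ∈ R[X_σ]` a polynomial whose `m`-leading coefficient is a unit of `R`. If `f`
divides `a ∈ R[X_σ]` after extension of coefficients to `S`, then `f` divides `a` in `R[X_σ]`:
`(f) S[X] ∩ R[X] = (f) R[X]` (multivariate division with remainder by `f`, and uniqueness of the
reduced remainder over the domain `S`). [folklore] -/
theorem dvd_of_map_dvd_map [IsDomain S] (m : MonomialOrder σ) {ι : R →+* S}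
    (hι : Function.Injective ι) {f a : MvPolynomial σ R} (hf : IsUnit (m.leadingCoeff f))
    (h : map ι f ∣ map ι a) : f ∣ a := by
  obtain ⟨g, r, hgr, -, hr⟩ := m.div_single hf a
  -- `map r` is divisible by `map f` over `S`
  have hdvd : map ι f ∣ map ι r := by
    have hr_eq : map ι r = map ι a - map ι g * map ι f := by
      rw [hgr, (map ι).map_add, (map ι).map_mul]; ring
    rw [hr_eq]
    exact dvd_sub h (dvd_mul_left _ _)
  obtain ⟨q, hq⟩ := hdvd
  by_cases hq0 : q = 0
  · rw [hq0, mul_zero] at hq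
    have hr0 : r = 0 := map_injective ι hι (by rw [hq, (map ι).map_zero])
    exact ⟨g, by rw [hgr, hr0, add_zero, mul_comm]⟩
  · exfalso
    have hιlc : ι (m.leadingCoeff f) ≠ 0 := (hf.map ι).ne_zero
    have hf0 : map ι f ≠ 0 := by
      intro h0
      apply hιlc
      rw [MonomialOrder.leadingCoeff, ← coeff_map, h0, coeff_zero]
    have hdeg : m.degree (map ι r) = m.degree f + m.degree q := by
      rw [hq, MonomialOrder.degree_mul hf0 hq0, monomialOrder_degree_map_of_injective m hι f]
    have hr0 : map ι r ≠ 0 := by rw [hq]; exact mul_ne_zero hf0 hq0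
    have hmem : m.degree f + m.degree q ∈ r.support := by
      rw [← support_map_of_injective r hι, ← hdeg]
      exact m.degree_mem_support hr0
    exact hr _ hmem le_self_add

/-- **Descent of primality.** Let `ι : R → S` be an injective ring map into a domain, `m` a
monomial order and `f ∈ R[X_σ]` with unit `m`-leading coefficient. If the image of `f` in
`S[X_σ]` is prime, then `f` is prime in `R[X_σ]` (`R[X]/(f) ↪ S[X]/(f)` by the contraction
lemma `dvd_of_map_dvd_map`). [folklore] -/
theorem prime_of_prime_map [IsDomain S] (m : MonomialOrder σ) {ι : R →+* S}
    (hι : Function.Injective ι) {f : MvPolynomial σ R} (hf : IsUnit (m.leadingCoeff f))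
    (hp : Prime (map ι f)) : Prime f := by
  refine ⟨fun h0 => hp.ne_zero (by rw [h0, (map ι).map_zero]),
    fun hu => hp.not_unit (hu.map (map ι)), fun a b hab => ?_⟩
  have hab' : map ι f ∣ map ι a * map ι b := by
    rw [← (map ι).map_mul]
    exact map_dvd (map ι) hab
  rcases hp.dvd_or_dvd hab' with h | h
  · exact Or.inl (dvd_of_map_dvd_map m hι hf h)
  · exact Or.inr (dvd_of_map_dvd_map m hι hf h)

end Descent

section Determinant

open Literature.Computability.AlgebraicComplexity

variable {n : Type*} [Fintype n] [DecidableEq n] {R : Type*} [CommRing R]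

/-- For ANY monomial order on the matrix positions, the leading coefficient of the generic
determinant `detPoly n R` over a nontrivial ring is a unit: all its coefficients are signs of
permutations (`coeff_detPoly`). [folklore] -/
theorem isUnit_leadingCoeff_detPoly [Nontrivial R] (m : MonomialOrder (n × n)) :
    IsUnit (m.leadingCoeff (detPoly n R)) := by
  have hne : detPoly n R ≠ 0 := by
    intro h0
    have := coeff_permMonomial_detPoly R (1 : Equiv.Perm n)
    rw [h0, coeff_zero] at this
    exact intCast_sign_ne_zero R (1 : Equiv.Perm n) this.symm
  have hlc : coeff (m.degree (detPoly n R)) (detPoly n R) ≠ 0 :=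
    m.coeff_degree_ne_zero_iff.mpr hne
  obtain ⟨ρ, hρ⟩ := exists_permMonomial_eq_of_coeff_detPoly_ne_zero R hlc
  rw [MonomialOrder.leadingCoeff, ← hρ, coeff_permMonomial_detPoly]
  exact isUnit_intCast_sign R ρ

/-- **The generic determinant is prime over every integral domain** `R`, for every non-empty
finite index type: `det (X_{ij})` generates a prime ideal of `R[X_{ij}]` (Jacobson, *Basic
Algebra I*, §7.2 over a field; the domain case by descent from `Frac R`, `prime_of_prime_map`,
since the leading coefficient `±1` of `det` is a unit). [folklore] -/
theorem detPoly_prime_of_isDomain [IsDomain R] [Nonempty n] : Prime (detPoly n R) := by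
  letI : LinearOrder (n × n) :=
    LinearOrder.lift' (Fintype.equivFin (n × n)) (Fintype.equivFin (n × n)).injective
  let m : MonomialOrder (n × n) := MonomialOrder.lex
  refine prime_of_prime_map m (IsFractionRing.injective R (FractionRing R))
    (isUnit_leadingCoeff_detPoly m) ?_
  rw [map_detPoly]
  exact detPoly_prime

/-- **The generic `k × k` determinant `det (X_{ij})` is prime in `D[X_{ij} : i, j < k]` for every
integral domain `D` and every `k ≥ 1`** (stub `stub_detPrimeOverDomain` of crux
`BeyondHessianNs`; `Matrix.of fun i j => X (i, j)` is Mathlib's `Matrix.mvPolynomialX`, whose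
determinant is the tree's `detPoly (Fin k) D`, prime by `detPoly_prime_of_isDomain`). [folklore] -/
theorem stub_detPrimeOverDomain : ∀ (D : Type) [CommRing D] [IsDomain D] (k : ℕ), 0 < k → Prime (Matrix.det (Matrix.of fun i j : Fin k => (MvPolynomial.X (i, j) : MvPolynomial (Fin k × Fin k) D))) := by
  intro D _ _ k hk
  haveI : Nonempty (Fin k) := ⟨⟨0, hk⟩⟩
  exact detPoly_prime_of_isDomain (n := Fin k) (R := D)

end Determinant

end Summit.ValiantsHypothesis.ValiantsHypothesis.Theorems.RefutationDegreeBeyondHessianNs
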